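import Summits.FinalStateConjecture.FinalStateConjecture.Theses.BartnikGapSettling
import Summits.FinalStateConjecture.FinalStateConjecture.Theorems.BartnikGapSettlingBondiBartnikRigidityTrivialRegime
import Literature.Geometry.Lorentzian.BondiBartnikGap

/-!
# Line `Sketch` for crux `BondiBartnikRigidity` (stmt-FinalStateConjecture-10807) — lead skeleton

(continuation c1, 2026-08-16: `stub_trivialRegime` discharged by the landed theorem p103152; the other five
stubs unchanged — three of them are FALSE as registered for `Λ > 1`, see `Lines/Sketch.dead.md`.)

Composition (pure logic, sorry-free outside the stubs):

`BondiBartnikRigidity` ⟸ `stub_trivialRegime` (Λ ≤ ε: the hypothesis leaf itself) ∧, for ε < Λ,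
  [`stub_cheapCompetitor` (ONE instantiation of the competitor clause: competitor masses
  `≤ Σ Mᵢ + ϵ`, card core-cone-calibration (2) / partial-hiding-vacuity S1) turns "gap ≤ γ" into the
  BUDGET "some own cut energy `≤ Σ Mᵢ + γ`"] and then by cases on `N`:
  * `N = 0`: `stub_lightConeRigidity` (light-cone positive-mass stability, cards K5/K4);
  * `N = 1`: `stub_kerrCollarFloor` ((KCM): every cut energy of a δ-Kerr collared core is
    `≥ M − ϑ`) pins the energy in `[M − ϑ, M + γ]`, and `stub_singleCollarCoercivity` (coercive
    cone rigidity + Cauchy stability, cards K1–K4) produces the leaf;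
  * `N ≥ 2`: `stub_multiCollarRigidity` (budget ⇒ leaf for several collars).
-/

noncomputable section

-- D-0017: single-problem summit, `Summit.<S>.<S>.…` by design (cf. lakefile `weak.linter.dupNamespace`).
set_option linter.dupNamespace false

open Set Filter Function Topology TopologicalSpace
open Literature.Geometry.Lorentzian
open scoped Manifold ContDiff Topology ENNReal BigOperators

namespace Summit.FinalStateConjecture.FinalStateConjecture.Cruxes.BondiBartnikRigidity.Sketch

/-! ## Stubs -/

/-- **Trivial regime.** If the geometry bound already beats the target (`Λ ≤ ε`, `k ≤ k'`) the
hypothesis leaf is itself the wanted leaf (`IsNearKerrLeaf.mono`, `S ⊆ J⁺(S)`). -/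
theorem stub_trivialRegime : ∀ (k k' : ℕ) (ε Λ : ℝ≥0∞), k ≤ k' → Λ ≤ ε →
    ∀ (X : Type) [TopologicalSpace X] [ChartedSpace E3 X] [IsManifold (𝓡 3) ∞ X]
      [T2Space X] [SecondCountableTopology X] [ConnectedSpace X]
      (D : InitialDataSet (𝓡 3) X) (𝒟 : VacuumCauchyDevelopment D) (N : ℕ) (M a : Fin N → ℝ)
      (S : Set 𝒟.carrier), 𝒟.toCauchyDevelopment.IsNearKerrLeaf k' Λ N M a S →
      ∃ S' : Set 𝒟.carrier, 𝒟.toCauchyDevelopment.IsNearKerrLeaf k ε N M a S' ∧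
        S' ⊆ 𝒟.metric.causalFuture 𝒟.timeOrientation S :=
  -- CLOSED: landed as `Theorems/BartnikGapSettlingBondiBartnikRigidityTrivialRegime.lean` (p103152).
  Summit.FinalStateConjecture.FinalStateConjecture.Theorems.stub_trivialRegime

/-- **Cheap competitors** (the single instantiation of the competitor clause): for δ-Kerr
collared cores on an MGHD of admissible data there are competitors of cut energy
`≤ Σ Mᵢ + ϵ` (capped / re-placed Kerr exteriors receiving the collars, a small-ball extension or a
cap receiving `p`); `N = 0`: small-ball competitors of energy `≤ ϵ`. -/
theorem stub_cheapCompetitor : ∀ (χ m₀ : ℝ) (N₀ : ℕ), χ < 1 → 0 < m₀ → ∃ k₂ : ℕ, ∀ ϵ : ℝ, 0 < ϵ →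
    ∃ δ₂ : ℝ≥0∞, 0 < δ₂ ∧
    ∀ (X : Type) [TopologicalSpace X] [ChartedSpace E3 X] [IsManifold (𝓡 3) ∞ X]
      [T2Space X] [SecondCountableTopology X] [ConnectedSpace X],
    ∀ D ∈ admissibleVacuumData X, ∀ (𝒟 : VacuumCauchyDevelopment D) (k' : ℕ) (Λ : ℝ≥0∞) (N : ℕ)
      (M a : Fin N → ℝ) (S : Set 𝒟.carrier) (p : 𝒟.carrier) (mo' : Fin N → lorentzGroup × E4)
      (B' : Fin N → ModelBackground) (Φ : ∀ i, (B' i).domain → 𝒟.carrier),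
    𝒟.IsMaximal → N ≤ N₀ → (∀ i, m₀ ≤ M i ∧ M i ≤ m₀⁻¹ ∧ |a i| ≤ χ * M i) →
    𝒟.toCauchyDevelopment.IsNearKerrLeaf k' Λ N M a S → p ∈ S →
    (∀ i, B' i = starBackground (mo' i).1 (mo' i).2 (M i) (a i)
      (fun x => Kerr.radius (a i) (poincareInv (mo' i).1 (mo' i).2 x))) →
    (∀ i, ContMDiffOn 𝓘(ℝ, E4) (𝓡 4) ∞ (Φ i)
        {x | -1 < (B' i).time x.1 ∧ (B' i).time x.1 < 1 ∧ (B' i).radius x.1 < 3 * M i + 1} ∧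
      Topology.IsOpenEmbedding ({x | -1 < (B' i).time x.1 ∧ (B' i).time x.1 < 1 ∧
        (B' i).radius x.1 < 3 * M i + 1}.restrict (Φ i))) →
    (∀ i, 𝒟.toSpacetime.truncDeviationCk (B' i) (Φ i) k₂ (3 * M i) 0 ≤ δ₂) →
    (∀ i, Φ i '' (B' i).truncTimeSlab (3 * M i) 0 ⊆ S) →
    Pairwise (Function.onFun Disjoint fun i => Φ i '' (B' i).truncTimeSlab (3 * M i) 0) →
    (∃ m : ℝ, 𝒟.toCauchyDevelopment.HasCutBondiMass
      ({p} ∪ ⋃ i, Φ i '' (B' i).truncTimeSlab (3 * M i) 0) m) →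
    ∃ m' : ℝ, 𝒟.IsCompetitorMass ({p} ∪ ⋃ i, Φ i '' (B' i).truncTimeSlab (3 * M i) 0) m' ∧
      m' ≤ (∑ i, M i) + ϵ := by
  sorry

/-- **Light-cone rigidity** (`N = 0`): on an MGHD of admissible data, a point `p` of a
`(Λ, k')`-leaf without holes whose cone cut has an energy `≤ γ` is followed by an
`(ε, k)`-near-Minkowski leaf in `J⁺(S)` (positive-mass stability at `𝓘⁺` in light-cone form). -/
theorem stub_lightConeRigidity : ∀ (k : ℕ) (ε : ℝ≥0∞), 0 < ε → ∃ k' : ℕ, ∀ Λ : ℝ≥0∞, Λ < ⊤ →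
    ε < Λ → ∃ γ : ℝ, 0 < γ ∧
    ∀ (X : Type) [TopologicalSpace X] [ChartedSpace E3 X] [IsManifold (𝓡 3) ∞ X]
      [T2Space X] [SecondCountableTopology X] [ConnectedSpace X],
    ∀ D ∈ admissibleVacuumData X, ∀ (𝒟 : VacuumCauchyDevelopment D) (M a : Fin 0 → ℝ)
      (S : Set 𝒟.carrier) (p : 𝒟.carrier),
    𝒟.IsMaximal → 𝒟.toCauchyDevelopment.IsNearKerrLeaf k' Λ 0 M a S → p ∈ S →
    (∃ m : ℝ, 𝒟.toCauchyDevelopment.HasCutBondiMass {p} m ∧ m ≤ γ) →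
    ∃ S' : Set 𝒟.carrier, 𝒟.toCauchyDevelopment.IsNearKerrLeaf k ε 0 M a S' ∧
      S' ⊆ 𝒟.metric.causalFuture 𝒟.timeOrientation S := by
  sorry

/-- **Kerr collar floor** ((KCM), the calibration, `N = 1`): every cut energy of a core
`{p} ∪ (δ-Kerr thick collar of mass M)` on an MGHD of admissible data is `≥ M − ϑ`, uniformly
(`k'` absolute, `δ = δ(χ, m₀, ϑ)`). -/
theorem stub_kerrCollarFloor : ∀ (χ m₀ : ℝ), χ < 1 → 0 < m₀ → ∃ k' : ℕ, ∀ ϑ : ℝ, 0 < ϑ →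
    ∃ δ : ℝ≥0∞, 0 < δ ∧
    ∀ (X : Type) [TopologicalSpace X] [ChartedSpace E3 X] [IsManifold (𝓡 3) ∞ X]
      [T2Space X] [SecondCountableTopology X] [ConnectedSpace X],
    ∀ D ∈ admissibleVacuumData X, ∀ (𝒟 : VacuumCauchyDevelopment D)
      (M a : Fin 1 → ℝ) (p : 𝒟.carrier) (mo' : Fin 1 → lorentzGroup × E4)
      (B' : Fin 1 → ModelBackground) (Φ : ∀ i, (B' i).domain → 𝒟.carrier),
    𝒟.IsMaximal → (∀ i, m₀ ≤ M i ∧ M i ≤ m₀⁻¹ ∧ |a i| ≤ χ * M i) →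
    (∀ i, B' i = starBackground (mo' i).1 (mo' i).2 (M i) (a i)
      (fun x => Kerr.radius (a i) (poincareInv (mo' i).1 (mo' i).2 x))) →
    (∀ i, ContMDiffOn 𝓘(ℝ, E4) (𝓡 4) ∞ (Φ i)
        {x | -1 < (B' i).time x.1 ∧ (B' i).time x.1 < 1 ∧ (B' i).radius x.1 < 3 * M i + 1} ∧
      Topology.IsOpenEmbedding ({x | -1 < (B' i).time x.1 ∧ (B' i).time x.1 < 1 ∧
        (B' i).radius x.1 < 3 * M i + 1}.restrict (Φ i))) →
    (∀ i, 𝒟.toSpacetime.truncDeviationCk (B' i) (Φ i) k' (3 * M i) 0 ≤ δ) →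
    ∀ m : ℝ, 𝒟.toCauchyDevelopment.HasCutBondiMass
      ({p} ∪ ⋃ i, Φ i '' (B' i).truncTimeSlab (3 * M i) 0) m → (∑ i, M i) - ϑ ≤ m := by
  sorry

/-- **Single-collar coercivity** (`N = 1`, the sharp case): a bounded-geometry leaf through a
δ-Kerr thick collar whose core has a cut energy pinned in `[M − ϑ, M + γ]` is followed by an
`(ε, k)`-near-Kerr leaf with the same `(M, a)` in `J⁺(S)` (coercive cone rigidity at Kerr's shear,
then Cauchy–characteristic stability; `ϑ, δ, γ` are produced here, after `Λ`). -/
theorem stub_singleCollarCoercivity : ∀ (χ m₀ : ℝ) (k : ℕ) (ε : ℝ≥0∞), χ < 1 → 0 < m₀ → 0 < ε →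
    ∃ k' : ℕ, ∀ Λ : ℝ≥0∞, Λ < ⊤ → ε < Λ →
    ∃ (δ : ℝ≥0∞) (γ ϑ : ℝ), 0 < δ ∧ 0 < γ ∧ 0 < ϑ ∧
    ∀ (X : Type) [TopologicalSpace X] [ChartedSpace E3 X] [IsManifold (𝓡 3) ∞ X]
      [T2Space X] [SecondCountableTopology X] [ConnectedSpace X],
    ∀ D ∈ admissibleVacuumData X, ∀ (𝒟 : VacuumCauchyDevelopment D)
      (M a : Fin 1 → ℝ) (S : Set 𝒟.carrier) (p : 𝒟.carrier) (mo' : Fin 1 → lorentzGroup × E4)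
      (B' : Fin 1 → ModelBackground) (Φ : ∀ i, (B' i).domain → 𝒟.carrier),
    𝒟.IsMaximal → (∀ i, m₀ ≤ M i ∧ M i ≤ m₀⁻¹ ∧ |a i| ≤ χ * M i) →
    𝒟.toCauchyDevelopment.IsNearKerrLeaf k' Λ 1 M a S → p ∈ S →
    (∀ i, B' i = starBackground (mo' i).1 (mo' i).2 (M i) (a i)
      (fun x => Kerr.radius (a i) (poincareInv (mo' i).1 (mo' i).2 x))) →
    (∀ i, ContMDiffOn 𝓘(ℝ, E4) (𝓡 4) ∞ (Φ i)
        {x | -1 < (B' i).time x.1 ∧ (B' i).time x.1 < 1 ∧ (B' i).radius x.1 < 3 * M i + 1} ∧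
      Topology.IsOpenEmbedding ({x | -1 < (B' i).time x.1 ∧ (B' i).time x.1 < 1 ∧
        (B' i).radius x.1 < 3 * M i + 1}.restrict (Φ i))) →
    (∀ i, 𝒟.toSpacetime.truncDeviationCk (B' i) (Φ i) k' (3 * M i) 0 ≤ δ) →
    (∀ i, Φ i '' (B' i).truncTimeSlab (3 * M i) 0 ⊆ S) →
    (∃ m : ℝ, 𝒟.toCauchyDevelopment.HasCutBondiMass
        ({p} ∪ ⋃ i, Φ i '' (B' i).truncTimeSlab (3 * M i) 0) m ∧
      (∑ i, M i) - ϑ ≤ m ∧ m ≤ (∑ i, M i) + γ) →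
    ∃ S' : Set 𝒟.carrier, 𝒟.toCauchyDevelopment.IsNearKerrLeaf k ε 1 M a S' ∧
      S' ⊆ 𝒟.metric.causalFuture 𝒟.timeOrientation S := by
  sorry

/-- **Multi-collar rigidity** (`2 ≤ N ≤ N₀`): a bounded-geometry leaf through `N` pairwise
disjoint δ-Kerr thick collars whose core has a cut energy `≤ Σ Mᵢ + γ` is followed by an
`(ε, k)`-near-Kerr leaf with the same `(N, M, a)` in `J⁺(S)` (δ → 0 forces the separations to
diverge, so the binding-energy slack `~ M² / D(δ)` vanishes with δ). -/
theorem stub_multiCollarRigidity : ∀ (χ m₀ : ℝ) (N₀ k : ℕ) (ε : ℝ≥0∞), χ < 1 → 0 < m₀ → 0 < ε →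
    ∃ k' : ℕ, ∀ Λ : ℝ≥0∞, Λ < ⊤ → ε < Λ → ∃ (δ : ℝ≥0∞) (γ : ℝ), 0 < δ ∧ 0 < γ ∧
    ∀ (X : Type) [TopologicalSpace X] [ChartedSpace E3 X] [IsManifold (𝓡 3) ∞ X]
      [T2Space X] [SecondCountableTopology X] [ConnectedSpace X],
    ∀ D ∈ admissibleVacuumData X, ∀ (𝒟 : VacuumCauchyDevelopment D) (N : ℕ)
      (M a : Fin N → ℝ) (S : Set 𝒟.carrier) (p : 𝒟.carrier) (mo' : Fin N → lorentzGroup × E4)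
      (B' : Fin N → ModelBackground) (Φ : ∀ i, (B' i).domain → 𝒟.carrier),
    𝒟.IsMaximal → 2 ≤ N → N ≤ N₀ → (∀ i, m₀ ≤ M i ∧ M i ≤ m₀⁻¹ ∧ |a i| ≤ χ * M i) →
    𝒟.toCauchyDevelopment.IsNearKerrLeaf k' Λ N M a S → p ∈ S →
    (∀ i, B' i = starBackground (mo' i).1 (mo' i).2 (M i) (a i)
      (fun x => Kerr.radius (a i) (poincareInv (mo' i).1 (mo' i).2 x))) →
    (∀ i, ContMDiffOn 𝓘(ℝ, E4) (𝓡 4) ∞ (Φ i)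
        {x | -1 < (B' i).time x.1 ∧ (B' i).time x.1 < 1 ∧ (B' i).radius x.1 < 3 * M i + 1} ∧
      Topology.IsOpenEmbedding ({x | -1 < (B' i).time x.1 ∧ (B' i).time x.1 < 1 ∧
        (B' i).radius x.1 < 3 * M i + 1}.restrict (Φ i))) →
    (∀ i, 𝒟.toSpacetime.truncDeviationCk (B' i) (Φ i) k' (3 * M i) 0 ≤ δ) →
    (∀ i, Φ i '' (B' i).truncTimeSlab (3 * M i) 0 ⊆ S) →
    Pairwise (Function.onFun Disjoint fun i => Φ i '' (B' i).truncTimeSlab (3 * M i) 0) →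
    (∃ m : ℝ, 𝒟.toCauchyDevelopment.HasCutBondiMass
        ({p} ∪ ⋃ i, Φ i '' (B' i).truncTimeSlab (3 * M i) 0) m ∧ m ≤ (∑ i, M i) + γ) →
    ∃ S' : Set 𝒟.carrier, 𝒟.toCauchyDevelopment.IsNearKerrLeaf k ε N M a S' ∧
      S' ⊆ 𝒟.metric.causalFuture 𝒟.timeOrientation S := by
  sorry

/-! ## Composition -/

/-- **The line closes the crux.** `BondiBartnikRigidity` from the six stubs by pure logic:
`k'` is the maximum of the stubs' derivative counts (and `k`), `δ`/`γ` the minima of their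
tolerances at the given `Λ`, the competitor clause is used once (`stub_cheapCompetitor` with
`ϵ = γ⋆/3`, `η = γ⋆/3`), and the budget case splits on `N ∈ {0, 1, ≥ 2}`. -/
theorem BondiBartnikRigidity_of :
    Summit.FinalStateConjecture.FinalStateConjecture.Theses.BartnikGapSettling.BondiBartnikRigidity := by
  intro χ m₀ N₀ k ε hχ hm₀ hε
  -- derivative counts of the stubs
  obtain ⟨k₂, hC⟩ := stub_cheapCompetitor χ m₀ N₀ hχ hm₀
  obtain ⟨k₀, hL⟩ := stub_lightConeRigidity k ε hε
  obtain ⟨k₃, hF⟩ := stub_kerrCollarFloor χ m₀ hχ hm₀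
  obtain ⟨k₁, hS⟩ := stub_singleCollarCoercivity χ m₀ k ε hχ hm₀ hε
  obtain ⟨k₄, hMu⟩ := stub_multiCollarRigidity χ m₀ N₀ k ε hχ hm₀ hε
  set k' : ℕ := max (max k k₀) (max (max k₁ k₂) (max k₃ k₄)) with hk'
  have hkk' : k ≤ k' := by omega
  have hk₀ : k₀ ≤ k' := by omega
  have hk₁ : k₁ ≤ k' := by omega
  have hk₂ : k₂ ≤ k' := by omega
  have hk₃ : k₃ ≤ k' := by omega
  have hk₄ : k₄ ≤ k' := by omega
  refine ⟨k', fun Λ hΛ => ?_⟩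
  by_cases hΛε : Λ ≤ ε
  · -- trivial regime: the hypothesis leaf itself
    refine ⟨1, 1, one_pos, one_pos, ?_⟩
    intro X _ _ _ _ _ _ D hD 𝒟 N M a S p mo' B' Φ hmax hN hwin hleaf hp hB hΦ hdev hsub hdis hcut
      hgap
    exact stub_trivialRegime k k' ε Λ hkk' hΛε X D 𝒟 N M a S hleaf
  · have hεΛ : ε < Λ := lt_of_not_ge hΛε
    obtain ⟨γ₀, hγ₀, hL'⟩ := hL Λ hΛ hεΛ
    obtain ⟨δ₁, γ₁, ϑ, hδ₁, hγ₁, hϑ, hS'⟩ := hS Λ hΛ hεΛ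
    obtain ⟨δ₄, γ₄, hδ₄, hγ₄, hMu'⟩ := hMu Λ hΛ hεΛ
    obtain ⟨δ₃, hδ₃, hF'⟩ := hF ϑ hϑ
    -- common budget slack γ⋆ and the competitor tolerance
    set γs : ℝ := min γ₀ (min γ₁ γ₄) with hγs
    have hγs0 : 0 < γs := lt_min hγ₀ (lt_min hγ₁ hγ₄)
    have hγs₀ : γs ≤ γ₀ := min_le_left _ _
    have hγs₁ : γs ≤ γ₁ := (min_le_right _ _).trans (min_le_left _ _)
    have hγs₄ : γs ≤ γ₄ := (min_le_right _ _).trans (min_le_right _ _)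
    obtain ⟨δ₂, hδ₂, hC'⟩ := hC (γs / 3) (by positivity)
    set δ : ℝ≥0∞ := min (min δ₁ δ₂) (min δ₃ δ₄) with hδ
    have hδ0 : 0 < δ := lt_min (lt_min hδ₁ hδ₂) (lt_min hδ₃ hδ₄)
    have hδδ₁ : δ ≤ δ₁ := (min_le_left _ _).trans (min_le_left _ _)
    have hδδ₂ : δ ≤ δ₂ := (min_le_left _ _).trans (min_le_right _ _)
    have hδδ₃ : δ ≤ δ₃ := (min_le_right _ _).trans (min_le_left _ _)
    have hδδ₄ : δ ≤ δ₄ := (min_le_right _ _).trans (min_le_right _ _)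
    refine ⟨δ, γs / 3, hδ0, by positivity, ?_⟩
    intro X _ _ _ _ _ _ D hD 𝒟 N M a S p mo' B' Φ hmax hN hwin hleaf hp hB hΦ hdev hsub hdis hcut
      hgap
    -- monotonicity of the collar closeness in `k` and `δ`
    have hdev_of : ∀ {kk : ℕ} {dd : ℝ≥0∞}, kk ≤ k' → δ ≤ dd →
        ∀ i, 𝒟.toSpacetime.truncDeviationCk (B' i) (Φ i) kk (3 * M i) 0 ≤ dd := by
      intro kk dd hkk hdd i
      exact ((supCkENorm_mono_right _ hkk _).trans (hdev i)).trans hdd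
    -- ONE instantiation of the competitor clause
    obtain ⟨m', hm', hm'le⟩ := hC' X D hD 𝒟 k' Λ N M a S p mo' B' Φ hmax hN hwin hleaf hp hB hΦ
      (hdev_of hk₂ hδδ₂) hsub hdis hcut
    obtain ⟨m, hm, hmle⟩ :=
      (VacuumCauchyDevelopment.bondiBartnikGapLE_iff.1 hgap) m' hm' (γs / 3) (by positivity)
    have hbudget : m ≤ (∑ i, M i) + γs := by linarith
    -- case split on the number of holes
    rcases N with _ | _ | n
    · -- N = 0: light-cone rigidity
      have hC0 : ({p} ∪ ⋃ i, Φ i '' (B' i).truncTimeSlab (3 * M i) 0) = ({p} : Set 𝒟.carrier) := by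
        simp
      have hsum0 : (∑ i, M i) = 0 := by simp
      rw [hC0] at hm
      rw [hsum0] at hbudget
      exact hL' X D hD 𝒟 M a S p hmax (hleaf.mono hk₀ le_rfl) hp
        ⟨m, hm, by linarith⟩
    · -- N = 1: floor + coercivity
      have hfloor : (∑ i, M i) - ϑ ≤ m :=
        hF' X D hD 𝒟 M a p mo' B' Φ hmax hwin hB hΦ (hdev_of hk₃ hδδ₃) m hm
      exact hS' X D hD 𝒟 M a S p mo' B' Φ hmax hwin (hleaf.mono hk₁ le_rfl) hp hB hΦ
        (hdev_of hk₁ hδδ₁) hsub ⟨m, hm, hfloor, by linarith⟩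
    · -- N ≥ 2: multi-collar rigidity
      exact hMu' X D hD 𝒟 (n + 2) M a S p mo' B' Φ hmax (by omega) hN hwin (hleaf.mono hk₄ le_rfl)
        hp hB hΦ (hdev_of hk₄ hδδ₄) hsub hdis ⟨m, hm, by linarith⟩

end Summit.FinalStateConjecture.FinalStateConjecture.Cruxes.BondiBartnikRigidity.Sketch

end
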